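import Mathlib
import Literature.NumberTheory.Sieve.ParityWave0Proofs
import HarnessLib

/-!
# Polynomial progressions in the primes (Tao–Ziegler 2008)

The **polynomial Szemerédi theorem for the primes** of T. Tao and T. Ziegler,
*The primes contain arbitrarily long polynomial progressions*, Acta Math. **201** (2008) 213–305,
Theorem 1.3 (= Theorem 3 of arXiv:math/0610050, p. 3):

> Let `A ⊂ P` be a set of primes of positive relative upper density in the primes, i.e.
> `limsup_{N → ∞} |A ∩ [N]| / |P ∩ [N]| > 0`. Then given any `P₁, …, P_k ∈ ℤ[m]` with
> `P₁(0) = … = P_k(0) = 0`, `A` contains infinitely many progressions of the form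
> `x + P₁(m), …, x + P_k(m)` with `m > 0`.

(`[N] = {1, …, N}`; the Erratum, Acta Math. **210** (2013) 403–404, corrects the proof — degree
bookkeeping in the polynomial forms / correlation conditions — and leaves the statement unchanged.)
This is a NAMED FACT (`TaoZiegler2008_polynomialProgressions`): the transference principle and the
uniform Bergelson–Leibman theorem behind it are far outside the tree.

PROVED here, from the tree's prime number theorem for arithmetic progressions
(`Literature.NumberTheory.Sieve.tendsto_primeCountingMod_mul_log_div`, Montgomery–Vaughan Cor. 11.20,
and `tendsto_primeCounting_mul_log_div`):

* `primeRelUpperDensity_setOf_prime_modEq` — for `q ≥ 1`, `(a, q) = 1` the primes `≡ a (mod q)`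
  have relative (upper) density `1/φ(q)` in the primes, hence positive;
* `TaoZiegler2008_polynomialProgressions.prime_modEq` — the fact applied to that set: infinitely
  many `(x, m)`, `m > 0`, with every `x + Pᵢ(m)` a prime `≡ a (mod q)` (the form used by
  Zywina 2025 §4 with `q = 24`, `a = 11`, `P = (0, 16m², 25m²)`).

Design: `A : Set ℕ`; "infinitely many progressions" is rendered as "the set of pairs
`(x, m) ∈ ℤ × ℤ`, `m > 0`, with all `x + Pᵢ(m) ∈ A` is infinite" (distinct progressions come from
distinct pairs, so this is implied by, and for non-constant patterns equivalent to, the printed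
conclusion); polynomials are `Polynomial ℤ` (the paper's `ℤ[m]`). Not here: the quantitative lower
bound of Remark 1.4/Remark 10 (`≫ N M / log^k N` pairs), the restriction `m ≤ x^ε`, and the
multidimensional version (Tao–Ziegler 2018, Forum Math. Pi).
-/

open Filter Asymptotics
open scoped Topology

namespace Literature.NumberTheory.Sieve

/-! ### Relative upper density in the primes -/

/-- The **relative upper density of `A ⊆ ℕ` in the primes**,
`limsup_{N → ∞} |A ∩ [N]| / |P ∩ [N]|` with `[N] = {1, …, N}` and `|P ∩ [N]| = π(N)`
(Tao–Ziegler 2008, statement of Thm 1.3). For `A ⊆ P` the ratio lies in `[0, 1]`, so the real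
`Filter.limsup` is the genuine limes superior. [cite: TaoZiegler2008, Thm 1.3 (arXiv Thm 3, p. 3)] -/
noncomputable def primeRelUpperDensity (A : Set ℕ) : ℝ :=
  Filter.limsup (fun N : ℕ => ((A ∩ Set.Icc 1 N).ncard : ℝ) / (Nat.primeCounting N : ℝ)) atTop

/-- Unfolding lemma for `primeRelUpperDensity`. [cite: TaoZiegler2008, Thm 1.3 (arXiv Thm 3, p. 3)] -/
theorem primeRelUpperDensity_def (A : Set ℕ) :
    primeRelUpperDensity A =
      Filter.limsup (fun N : ℕ => ((A ∩ Set.Icc 1 N).ncard : ℝ) / (Nat.primeCounting N : ℝ)) atTop :=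
  rfl

/-- If the density ratio `|A ∩ [N]| / π(N)` converges to `δ`, the relative upper density is `δ`
(a set with a natural relative density in the primes has that relative upper density).
[cite: TaoZiegler2008, Thm 1.3 (arXiv Thm 3, p. 3), the hypothesis] -/
theorem primeRelUpperDensity_eq_of_tendsto {A : Set ℕ} {δ : ℝ}
    (h : Tendsto (fun N : ℕ => ((A ∩ Set.Icc 1 N).ncard : ℝ) / (Nat.primeCounting N : ℝ)) atTop (𝓝 δ)) :
    primeRelUpperDensity A = δ :=
  h.limsup_eq

/-! ### The named fact -/

/-- **Tao–Ziegler 2008, Theorem 1.3 (polynomial Szemerédi theorem for the primes).**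
"Let `A ⊂ P` be a set of primes of positive relative upper density in the primes, i.e.
`limsup_{N→∞} |A ∩ [N]| / |P ∩ [N]| > 0`. Then given any `P₁, …, P_k ∈ ℤ[m]` with
`P₁(0) = … = P_k(0) = 0`, `A` contains infinitely many progressions of the form
`x + P₁(m), …, x + P_k(m)` with `m > 0`."  Rendered: the set of pairs `(x, m) ∈ ℤ × ℤ` with `m > 0`
and `x + Pᵢ(m) ∈ A` for every `i` is infinite.  NAMED FACT (Green–Tao transference for polynomial
systems + uniform Bergelson–Leibman; not in the tree).  The 2013 Erratum (Acta Math. 210, 403–404)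
amends the proof only (bib `TaoZiegler2013`). [cite: TaoZiegler2008, Thm 1.3 (arXiv math/0610050 Thm 3, p. 3)] -/
def TaoZiegler2008_polynomialProgressions : Prop :=
  ∀ (A : Set ℕ), A ⊆ {p | p.Prime} → 0 < primeRelUpperDensity A →
    ∀ (k : ℕ) (P : Fin k → Polynomial ℤ), (∀ i, (P i).eval 0 = 0) →
      {xm : ℤ × ℤ | 0 < xm.2 ∧ ∀ i, ∃ a ∈ A, (a : ℤ) = xm.1 + (P i).eval xm.2}.Infinite

/-! ### Primes in a fixed residue class have positive relative density -/

/-- `|{p prime : p ≡ a (mod q)} ∩ [N]| = π(N; q, a)`. [folklore] -/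
private theorem ncard_setOf_prime_modEq_inter_Icc (q a N : ℕ) :
    ({p : ℕ | p.Prime ∧ p ≡ a [MOD q]} ∩ Set.Icc 1 N).ncard = ParityWave0.primeCountingMod q a N := by
  classical
  rw [ParityWave0.primeCountingMod, ← Set.ncard_coe_finset]
  congr 1
  ext p
  simp only [Set.mem_inter_iff, Set.mem_setOf_eq, Set.mem_Icc, Finset.coe_filter,
    Finset.mem_range]
  constructor
  · rintro ⟨⟨hp, hmod⟩, -, hle⟩
    exact ⟨by omega, hp, hmod⟩
  · rintro ⟨hlt, hp, hmod⟩
    exact ⟨⟨hp, hmod⟩, hp.one_lt.le, by omega⟩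

/-- **Prime number theorem in arithmetic progressions, relative form**: for `q ≥ 1`, `(a, q) = 1`,
`π(N; q, a) / π(N) → 1/φ(q)` (quotient of the tree's `π(N; q, a) log N / N → 1/φ(q)`,
Montgomery–Vaughan Cor. 11.20, by `π(N) log N / N → 1`). [cite: MontgomeryVaughan2007, Cor. 11.20 (11.33)] -/
theorem tendsto_primeCountingMod_div_primeCounting {q a : ℕ} (hq : q ≠ 0) (h : a.Coprime q) :
    Tendsto (fun N : ℕ => (ParityWave0.primeCountingMod q a N : ℝ) / (Nat.primeCounting N : ℝ))
      atTop (𝓝 ((Nat.totient q : ℝ)⁻¹)) := by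
  have h1 := tendsto_primeCountingMod_mul_log_div hq h
  have h2 := tendsto_primeCounting_mul_log_div
  have h3 := h1.div h2 one_ne_zero
  rw [div_one] at h3
  refine h3.congr' ?_
  filter_upwards [eventually_ge_atTop 2] with N hN
  have hN0 : (N : ℝ) ≠ 0 := by positivity
  have hlog : Real.log N ≠ 0 := (Real.log_pos (by exact_mod_cast hN)).ne'
  have hπ : (Nat.primeCounting N : ℝ) ≠ 0 := by
    have : Nat.primeCounting N ≠ 0 := fun h0 => by
      have := Nat.primeCounting_eq_zero_iff.mp h0
      omega
    exact_mod_cast this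
  simp only [Pi.div_apply]
  field_simp

/-- For `q ≥ 1` and `(a, q) = 1` the primes `≡ a (mod q)` have relative upper density `1/φ(q)` in
the primes (prime number theorem in arithmetic progressions). [cite: MontgomeryVaughan2007, Cor. 11.20 (11.33)] -/
theorem primeRelUpperDensity_setOf_prime_modEq {q a : ℕ} (hq : q ≠ 0) (h : a.Coprime q) :
    primeRelUpperDensity {p : ℕ | p.Prime ∧ p ≡ a [MOD q]} = (Nat.totient q : ℝ)⁻¹ := by
  refine primeRelUpperDensity_eq_of_tendsto ?_
  simp only [ncard_setOf_prime_modEq_inter_Icc]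
  exact tendsto_primeCountingMod_div_primeCounting hq h

/-- … hence positive relative upper density. [cite: MontgomeryVaughan2007, Cor. 11.20 (11.33)] -/
theorem primeRelUpperDensity_setOf_prime_modEq_pos {q a : ℕ} (hq : q ≠ 0) (h : a.Coprime q) :
    0 < primeRelUpperDensity {p : ℕ | p.Prime ∧ p ≡ a [MOD q]} := by
  rw [primeRelUpperDensity_setOf_prime_modEq hq h]
  have : 0 < Nat.totient q := Nat.totient_pos.mpr (Nat.pos_of_ne_zero hq)
  positivity

/-! ### The fact applied to primes in a residue class -/

/-- **Tao–Ziegler in a residue class** (Thm 1.3 applied to `A = {p prime : p ≡ a (mod q)}`, whose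
relative density `1/φ(q) > 0` is the prime number theorem in arithmetic progressions — the form in
which Zywina 2025 §4 invokes [TZ, Thm 1.3] with `q = 24`, `a = 11`): for `q ≥ 1`, `(a, q) = 1` and
`Pᵢ ∈ ℤ[m]` with `Pᵢ(0) = 0`, there are infinitely many `(x, m)`, `m > 0`, such that every
`x + Pᵢ(m)` is a prime `≡ a (mod q)`. PROVED modulo the named fact. [cite: TaoZiegler2008, Thm 1.3 (arXiv Thm 3, p. 3)] -/
theorem TaoZiegler2008_polynomialProgressions.prime_modEq
    (hTZ : TaoZiegler2008_polynomialProgressions) {q a : ℕ} (hq : q ≠ 0) (h : a.Coprime q)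
    {k : ℕ} (P : Fin k → Polynomial ℤ) (hP : ∀ i, (P i).eval 0 = 0) :
    {xm : ℤ × ℤ | 0 < xm.2 ∧
      ∀ i, ∃ p ∈ {p : ℕ | p.Prime ∧ p ≡ a [MOD q]}, (p : ℤ) = xm.1 + (P i).eval xm.2}.Infinite :=
  hTZ _ (fun _ hp => hp.1) (primeRelUpperDensity_setOf_prime_modEq_pos hq h) k P hP

/-- The case `A = P` (Tao–Ziegler 2008, Thm 1.3 with `A` the set of all primes, relative density `1`):
infinitely many `(x, m)`, `m > 0`, with all `x + Pᵢ(m)` prime. PROVED modulo the named fact.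
[cite: TaoZiegler2008, Thm 1.3 (arXiv Thm 3, p. 3)] -/
theorem TaoZiegler2008_polynomialProgressions.prime
    (hTZ : TaoZiegler2008_polynomialProgressions)
    {k : ℕ} (P : Fin k → Polynomial ℤ) (hP : ∀ i, (P i).eval 0 = 0) :
    {xm : ℤ × ℤ | 0 < xm.2 ∧ ∀ i, ∃ p : ℕ, p.Prime ∧ (p : ℤ) = xm.1 + (P i).eval xm.2}.Infinite := by
  have h := TaoZiegler2008_polynomialProgressions.prime_modEq hTZ one_ne_zero
    (Nat.coprime_one_right 0) P hP
  refine h.mono ?_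
  rintro ⟨x, m⟩ ⟨hm, hall⟩
  refine ⟨hm, fun i => ?_⟩
  obtain ⟨p, ⟨hp, -⟩, hpx⟩ := hall i
  exact ⟨p, hp, hpx⟩

end Literature.NumberTheory.Sieve
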